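import Literature.Barriers.AtomisticToContinuum.DisorderedHarmonicChainSpectral
import Mathlib.MeasureTheory.Measure.Lebesgue.Integral
import Mathlib.MeasureTheory.Integral.Prod
import Mathlib.Analysis.Complex.Exponential
import HarnessLib

/-!
# Ajanki–Huveneers 2011, Thm 1.1: transfer matrices, the current density `j_n`, and the reduction of the spectral scaling law to the three bounds of §6

Third file of the Casher–Lebowitz / Ajanki–Huveneers cluster of the barrier catalogue
`Literature/Barriers/AtomisticToContinuum/` (sub-problem `FouriersLaw`):
`DisorderedHarmonicChain.lean` vendors Theorem 1.1 on the SDE side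
(`AjankiHuveneers2011_scaling`), `DisorderedHarmonicChainSpectral.lean` reduces it to the
transmission-integral form `AjankiHuveneers2011_spectralScaling`
(`K n^{-3/2} ≤ 𝔼[clSpectralConductance] ≤ K' n^{-3/2}`, provefact unit SIZE XL), and this file
carries out the next layer of that decomposition, following the paper (O. Ajanki, F. Huveneers,
CMP **301** (2011) 841–883, arXiv:1003.1076):

* **§2.1 made formal and PROVED.** The matrix elements `D_n(v)` of the transfer-matrix product
  (`ahD`, eq. (2.2); `Q_n = A_n⋯A_1 = [[D_n(e₁), D_n(e₂)],[D_{n-1}(e₁), D_{n-1}(e₂)]]`, eq. (2.3)),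
  `det Q_n = 1` (`ahD_casorati`), the continuant formula for tridiagonal determinants
  (`det_triDiag`), and from it the identity behind eqs. (1.2)/(2.5):
  `det Z_n(ω) = v_nᵀ Q_n(ω) v_1` for the impedance matrix `clImpedance` of the Casher–Lebowitz
  chain, `v_1 = e₁ + iλm₁ω e₂`, `v_n = e₁ - iλm_nω e₂` (`det_clImpedance`,
  `normSq_det_clImpedance`). Hence the transmission integrand `λ²m₁m_nω²/|det Z_n(ω)|²` of
  `clSpectralConductance` is squeezed between constant multiples of the paper's current density
  `j_n(ω) = |ṽ_nᵀQ_nṽ_1|^{-2} = (2 + ω⁻²D_n(e₁)² + D_{n-1}(e₁)² + D_n(e₂)² + ω²D_{n-1}(e₂)²)⁻¹`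
  (`clCurrentDensity`, eq. (2.7)) as soon as the masses lie in a compact `[a,b] ⊂ (0,∞)`
  (`clSpectralIntegrand_bounds`, `clSpectralConductance_bounds`; this is the sentence "Since the
  masses have a compact support … and the bath vectors are symmetric in `w`, one has
  `J^CL_n ∼ (T_1 - T_n)∫_ℝ |v_{CL,n}ᵀ Q_n v_{CL,1}|^{-2} dw ∼ ∫_0^∞ j_n(w) dw =: J_n`", eq. (2.6)).
* **§6 as three NAMED FACTS** about the mass average `𝔼 j_n(ω)` (`clAvgCurrentDensity`):
  (U) `AjankiHuveneers2011_lowFrequencyBound` — `∫_0^{ω₀} 𝔼 j_n ≲ n^{-3/2}` (§6.2, the terms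
  `𝒥₁ + 𝒥₂` of (6.4), from Cor. 3.6, Prop. 4.1, Prop. 5.1); (H)
  `AjankiHuveneers2011_highFrequencyBound` — `∫_{ω₀}^∞ 𝔼 j_n ≲ e^{-c√n}` for every `ω₀ > 0`
  (the term `𝒥₃`, "already shown by O'Connor", Thm 6 of CMP 45 (1975)); (L)
  `AjankiHuveneers2011_criticalBandLowerBound` — `𝔼 j_n(ω) ≳ ω²` on the band
  `κ/√(2n) ≤ ω ≤ κ/√n` (§6.1, from Cor. 3.6, Lemma 3.7, Prop. 5.1, Lemma 6.1).
* **The reduction PROVED**: `AjankiHuveneers2011_spectralScaling_of_bounds : (U) → (H) → (L) →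
  AjankiHuveneers2011_spectralScaling` (a.s. masses in `[a,b]`, the comparison above, Fubini,
  evenness in `ω`, `∫_0^∞ = ∫_0^{ω₀} + ∫_{ω₀}^∞`, `e^{-c√n} ≤ 6/(c³n^{3/2})`, and the band integral
  `∫_{κ/√(2n)}^{κ/√n} cω² dω = cκ³(1 - 1/√2)/(2n^{3/2})`).

## Sources

* O. Ajanki, F. Huveneers, CMP 301 (2011) 841–883, arXiv:1003.1076: §1 eq. (1.2), §1.1,
  Thm 1.1, §2 (`B_k`, `A_k(w) = [[2 - π²w²(1+B_k), -1],[1,0]]`, O'Connor's reduction to `]0,w₀]`),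
  §2.1 eqs. (2.2)–(2.7), §2.2 (outline), §6.1 (lower bound: "it is therefore enough to show that
  when `1/2 ≤ w²n ≤ 1` the bound `𝔼 j_n(w) ≳ w²` holds"), §6.2 (upper bound (6.4)–(6.9) and "It has
  already been shown by O'Connor [O'Connor-75] that `𝒥₃ ≲ e^{-Cn^{1/2}}`").
* A. J. O'Connor, CMP 45 (1975) 63–77, Thm 6 — cited as invoked by Ajanki–Huveneers (paywalled,
  not re-read; acquisition requested).
* A. Dhar, Adv. Phys. 57 (2008) 457–537, §3.4.1 (`T̂_l = [[2 - m_lω², -1],[1,0]]`, `Δ_N` as a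
  product of transfer matrices, `|G_{1N}| = 1/|Δ_N|`).

## Design notes

* Frequencies. The paper works with the rescaled frequency `w`, `ω = πw/√(𝔼M)` (so that
  `m_kω² = π²w²(1+B_k)` and `A_k(w)` IS Dhar's `T_k(ω)`), and with bath vectors normalised to
  `α M_k w = w`; both normalisations change `j_n` and its frequency integrals only by constant
  factors depending on `𝔼M ∈ [a,b]`, `λ`, `a`, `b` ("as far as the scaling behavior goes", §1.1).
  Everything here is stated in the physical `ω` of `clImpedance`; the facts (U), (H), (L) are the
  printed `≲`-statements read in `ω` (threshold `ω₀`, band constant `κ` existential).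
* `clCurrentDensity` is written as `ω²/(2ω² + D_n(e₁)² + ω²(D_{n-1}(e₁)² + D_n(e₂)²) + ω⁴D_{n-1}(e₂)²)`:
  no division by `ω`, value in `[0, 1/2]`, even in `ω`, jointly continuous numerator/denominator
  (measurability is all the assembly needs); `0` for the empty chain. The paper prints the
  bracket with `1 +` where expanding `|v_nᵀQ_nv_1|²` with `det Q_n = 1` gives `2 +` (immaterial
  at the `∼` level).
* `clSpectralConductance_bounds` is junk-robust: the two integrands are pointwise comparable and
  measurable, so either both frequency integrals converge or both are the Bochner junk `0`.
  Integrability over the masses is supplied in the assembly by Fubini from the finiteness of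
  `∫_ℝ 𝔼 j_n`, which is part of what (U)+(H) assert.
* NOT here (next layer of the decomposition, needed to discharge (U) and (L)): the Prüfer-type
  coordinates `g`, `ϑ(w)`, `f_b`, the Markov chain `X^x_n` on `𝕋` and the amplitude `Γ^x_n`
  (§3), Prop. 3.5/Cor. 3.6, Cor. 3.4, Lemma 3.7, Prop. 4.1 (`𝔼(1/Γ_n) ≲ e^{-αw²n}`, Freedman/Azuma),
  Prop. 5.1 (potential theory), Lemma 6.1; and O'Connor's theorem itself for (H).
-/

noncomputable section

open MeasureTheory Matrix Filter

namespace Literature.Barriers.AtomisticToContinuum.HeatConduction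

open Literature.MathematicalPhysics.KineticTheory.HeatConduction

section Continuant

variable {R : Type*} [CommRing R]

/-- **The matrix elements `D_n(v)` of the transfer-matrix product** (AH2011 §2.1 eq. (2.2)): for a
diagonal symbol `d : ℕ → R` (site `k+1 ↦ d k`; `d k = 2 - π²w²(1+B_{k+1})` in the paper's
variables, `2 - m_{k+1}ω²` in Dhar's) and an initial vector `v = (v₀, v₋₁)`:
`D_0 = v₀`, `D_{-1} = v₋₁`, `D_n = d_n D_{n-1} - D_{n-2}`; `ahD d v₀ v₋₁ n = D_n(v)`. Then
`Q_n = A_n⋯A_1 = [[D_n(e₁), D_n(e₂)], [D_{n-1}(e₁), D_{n-1}(e₂)]]` (eq. (2.3)), `e₁ = (1,0)`,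
`e₂ = (0,1)`. Over any commutative ring. [cite: AjankiHuveneers2011, §2.1 eqs. (2.2)-(2.3)] -/
def ahD (d : ℕ → R) (v₀ v₁ : R) : ℕ → R
  | 0 => v₀
  | 1 => d 0 * v₀ - v₁
  | n + 2 => d (n + 1) * ahD d v₀ v₁ (n + 1) - ahD d v₀ v₁ n

/-- `D_0(v) = v₀`. [cite: AjankiHuveneers2011, §2.1 eq. (2.2)] -/
@[simp] theorem ahD_zero (d : ℕ → R) (v₀ v₁ : R) : ahD d v₀ v₁ 0 = v₀ := rfl

/-- `D_1(v) = d_1 v₀ - v₋₁`. [cite: AjankiHuveneers2011, §2.1 eq. (2.2)] -/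
@[simp] theorem ahD_one (d : ℕ → R) (v₀ v₁ : R) : ahD d v₀ v₁ 1 = d 0 * v₀ - v₁ := rfl

/-- The three-term recursion `D_n = d_n D_{n-1} - D_{n-2}`. [cite: AjankiHuveneers2011, §2.1 eq. (2.2)] -/
theorem ahD_add_two (d : ℕ → R) (v₀ v₁ : R) (n : ℕ) :
    ahD d v₀ v₁ (n + 2) = d (n + 1) * ahD d v₀ v₁ (n + 1) - ahD d v₀ v₁ n := rfl

/-- Linearity in the initial vector: `D_n(v) = v₀ D_n(e₁) + v₋₁ D_n(e₂)` ("by the linearity of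
the system (2.2)"). [cite: AjankiHuveneers2011, §3.1 (remark after Prop. 3.5)] -/
theorem ahD_eq_lin (d : ℕ → R) (v₀ v₁ : R) :
    ∀ n, ahD d v₀ v₁ n = v₀ * ahD d 1 0 n + v₁ * ahD d 0 1 n
  | 0 => by simp
  | 1 => by simp; ring
  | n + 2 => by
    rw [ahD_add_two, ahD_add_two, ahD_add_two, ahD_eq_lin d v₀ v₁ (n + 1), ahD_eq_lin d v₀ v₁ n]
    ring

/-- **`det Q_n = 1`**: `D_{n+1}(e₁) D_n(e₂) - D_n(e₁) D_{n+1}(e₂) = det(A_{n+1}⋯A_1) = 1`.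
[cite: AjankiHuveneers2011, §2.1 (before eq. (2.7))] -/
theorem ahD_casorati (d : ℕ → R) :
    ∀ n, ahD d 1 0 (n + 1) * ahD d 0 1 n - ahD d 1 0 n * ahD d 0 1 (n + 1) = 1
  | 0 => by simp
  | n + 1 => by
    rw [ahD_add_two, ahD_add_two]
    have ih := ahD_casorati d n
    linear_combination ih

/-- `D_n(v)` only depends on `d_1, …, d_n`. [folklore] -/
theorem ahD_congr {d d' : ℕ → R} (v₀ v₁ : R) :
    ∀ n, (∀ k, k < n → d k = d' k) → ahD d v₀ v₁ n = ahD d' v₀ v₁ n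
  | 0 => fun _ => rfl
  | 1 => fun h => by simp [h 0 (by omega)]
  | n + 2 => fun h => by
    rw [ahD_add_two, ahD_add_two, h (n + 1) (by omega),
      ahD_congr v₀ v₁ (n + 1) (fun k hk => h k (by omega)), ahD_congr v₀ v₁ n (fun k hk => h k (by omega))]

/-- Forward form of the recursion (peeling off the FIRST site):
`D_{n+2}(e₁)[d] = d_1 · D_{n+1}(e₁)[d_{·+1}] - D_n(e₁)[d_{·+2}]`. [folklore] -/
theorem ahD_fwd (d : ℕ → R) :
    ∀ n, ahD d 1 0 (n + 2) =
      d 0 * ahD (fun k => d (k + 1)) 1 0 (n + 1) - ahD (fun k => d (k + 2)) 1 0 n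
  | 0 => by simp [ahD_add_two]; ring
  | 1 => by simp [ahD_add_two]; ring
  | n + 2 => by
    have e1 : ahD d 1 0 (n + 4) = d (n + 3) * ahD d 1 0 (n + 3) - ahD d 1 0 (n + 2) := rfl
    have e4 : ahD (fun k => d (k + 1)) 1 0 (n + 3) =
        d (n + 3) * ahD (fun k => d (k + 1)) 1 0 (n + 2) - ahD (fun k => d (k + 1)) 1 0 (n + 1) :=
      rfl
    have e5 : ahD (fun k => d (k + 2)) 1 0 (n + 2) =
        d (n + 3) * ahD (fun k => d (k + 2)) 1 0 (n + 1) - ahD (fun k => d (k + 2)) 1 0 n := rfl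
    rw [e1, ahD_fwd d (n + 1), ahD_fwd d n, e4, e5]
    ring

/-- The tridiagonal matrix with diagonal `z` and both off-diagonals `-1` (the shape of the
impedance matrix `Z_n(ω)` of the chain, Dhar's `Ẑ = -ω²M̂ + Φ̂ - Σ̂`). [folklore] -/
def triDiag {n : ℕ} (z : Fin n → R) : Matrix (Fin n) (Fin n) R :=
  Matrix.of fun i j => if i = j then z i else if i.val + 1 = j.val ∨ j.val + 1 = i.val then -1 else 0

/-- Entries of `triDiag`. [folklore] -/
theorem triDiag_apply {n : ℕ} (z : Fin n → R) (i j : Fin n) :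
    triDiag z i j = if i = j then z i else if i.val + 1 = j.val ∨ j.val + 1 = i.val then -1 else 0 :=
  rfl

/-- Extension of a `Fin n`-indexed sequence to `ℕ` by `0` (only the entries below `n` are ever
used by `D_k`, `k ≤ n`). [folklore] -/
def finExt {n : ℕ} (z : Fin n → R) (k : ℕ) : R := if h : k < n then z ⟨k, h⟩ else 0

/-- `finExt z k = z_k` below `n`. [folklore] -/
theorem finExt_of_lt {n : ℕ} (z : Fin n → R) {k : ℕ} (hk : k < n) : finExt z k = z ⟨k, hk⟩ := by
  simp [finExt, hk]

/-- Shifting the extension by one. [folklore] -/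
theorem finExt_succ {n : ℕ} (z : Fin (n + 1) → R) :
    finExt (z ∘ Fin.succ) = fun k => finExt z (k + 1) := by
  funext k
  simp only [finExt, Function.comp_apply]
  by_cases hk : k < n
  · rw [dif_pos hk, dif_pos (by omega)]
    rfl
  · rw [dif_neg hk, dif_neg (by omega)]

/-- Shifting the extension by two. [folklore] -/
theorem finExt_succ_succ {n : ℕ} (z : Fin (n + 2) → R) :
    finExt (z ∘ Fin.succ ∘ Fin.succ) = fun k => finExt z (k + 2) := by
  funext k
  simp only [finExt, Function.comp_apply]
  by_cases hk : k < n
  · rw [dif_pos hk, dif_pos (by omega)]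
    rfl
  · rw [dif_neg hk, dif_neg (by omega)]

/-- Deleting the first row and column of a tridiagonal matrix. [folklore] -/
theorem triDiag_submatrix_succ {n : ℕ} (z : Fin (n + 1) → R) :
    (triDiag z).submatrix Fin.succ Fin.succ = triDiag (z ∘ Fin.succ) := by
  ext i j
  simp only [submatrix_apply, triDiag_apply, Fin.succ_inj, Fin.val_succ, Function.comp_apply]
  by_cases h : i = j
  · simp [h]
  · rw [if_neg h, if_neg h]
    congr 1
    apply propext
    omega

/-- **Tridiagonal determinant = continuant = transfer-matrix element**:
`det (triDiag z) = D_n(e₁)` for the diagonal symbol `z` (Laplace expansion along the first row,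
then along the first column; "`Δ_N` … products of random matrices `T̂_l`").
[cite: Dhar2008, §3.4.1] -/
theorem det_triDiag : ∀ {n : ℕ} (z : Fin n → R), (triDiag z).det = ahD (finExt z) 1 0 n
  | 0, z => by simp [Matrix.det_isEmpty]
  | 1, z => by
    rw [Matrix.det_unique, ahD_one, triDiag_apply]
    simp [finExt]
  | n + 2, z => by
    rw [Matrix.det_succ_row_zero, Fin.sum_univ_succ, Fin.sum_univ_succ,
      Finset.sum_eq_zero (fun (j : Fin n) _ => ?_), add_zero]
    · have hA00 : triDiag z 0 0 = z 0 := by simp [triDiag_apply]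
      have hA01 : triDiag z 0 (Fin.succ 0) = -1 := by
        simp [triDiag_apply]
      have hM0 : (triDiag z).submatrix Fin.succ (Fin.succAbove 0) = triDiag (z ∘ Fin.succ) := by
        rw [Fin.succAbove_zero]
        exact triDiag_submatrix_succ z
      have hM1 : ((triDiag z).submatrix Fin.succ (Fin.succAbove (Fin.succ 0))).det =
          -(triDiag (z ∘ Fin.succ ∘ Fin.succ)).det := by
        rw [Matrix.det_succ_column_zero, Fin.sum_univ_succ,
          Finset.sum_eq_zero (fun (i : Fin n) _ => ?_), add_zero]
        · have hN00 : ((triDiag z).submatrix Fin.succ (Fin.succAbove (Fin.succ 0))) 0 0 = -1 := by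
            simp only [submatrix_apply, Fin.succ_zero_eq_one, Fin.one_succAbove_zero,
              triDiag_apply]
            simp
          have hN : ((triDiag z).submatrix Fin.succ (Fin.succAbove (Fin.succ 0))).submatrix
              (Fin.succAbove 0) Fin.succ = triDiag (z ∘ Fin.succ ∘ Fin.succ) := by
            ext i j
            simp only [submatrix_apply, Fin.succ_zero_eq_one, Fin.one_succAbove_succ,
              Fin.succAbove_zero, triDiag_apply, Fin.val_succ, Function.comp_apply, Fin.succ_inj]
            by_cases h : i = j
            · simp [h]
            · rw [if_neg h, if_neg h]
              congr 1
              apply propext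
              omega
          rw [hN00, hN]
          simp
        · simp only [submatrix_apply, Fin.succ_zero_eq_one, Fin.one_succAbove_zero,
            triDiag_apply, Fin.val_succ, Fin.val_zero]
          rw [if_neg (by simp [Fin.ext_iff]), if_neg (by omega)]
          simp
      rw [hA00, hA01, hM0, hM1, det_triDiag (z ∘ Fin.succ), det_triDiag (z ∘ Fin.succ ∘ Fin.succ),
        ahD_fwd, finExt_succ, finExt_succ_succ, finExt_of_lt z (by omega : 0 < n + 2)]
      simp [sub_eq_add_neg]
    · have : triDiag z 0 j.succ.succ = 0 := by
        rw [triDiag_apply, if_neg (by simp [Fin.ext_iff]), if_neg (by simp)]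
      rw [this]
      ring

end Continuant

end Literature.Barriers.AtomisticToContinuum.HeatConduction

namespace Literature.Barriers.AtomisticToContinuum.HeatConduction

open Literature.MathematicalPhysics.KineticTheory.HeatConduction

section ChainEntries

variable {R : Type*} [CommRing R]

/-- A perturbation `-c` of the FIRST diagonal entry moves into the initial vector:
`D_n[(d_1 - c, d_2, …)](v₀, v₋₁) = D_n[d](v₀, v₋₁ + c v₀)` — this is how the left bath
self-energy becomes the bath vector `v_1 = e₁ + iλm₁ω e₂`. [folklore] -/
theorem ahD_sub_at_zero (d : ℕ → R) (c v₀ v₁ : R) :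
    ∀ n, ahD (fun j => if j = 0 then d 0 - c else d j) v₀ v₁ n = ahD d v₀ (v₁ + c * v₀) n
  | 0 => rfl
  | 1 => by simp; ring
  | n + 2 => by
    rw [ahD_add_two, ahD_add_two, ahD_sub_at_zero d c v₀ v₁ (n + 1), ahD_sub_at_zero d c v₀ v₁ n,
      if_neg (by omega)]

/-- A perturbation `-c` of the LAST diagonal entry: `D_{k+1}[e] = D_{k+1}[e₁] - c D_k[e₁]` when
`e` and `e₁` agree below `k` and `e_k = (e₁)_k - c` (the right bath vector `v_n = e₁ - iλm_nω e₂`).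
[folklore] -/
theorem ahD_sub_at_last {e e₁ : ℕ → R} {c : R} (v₀ v₁ : R) {k : ℕ}
    (hlt : ∀ j, j < k → e j = e₁ j) (hk : e k = e₁ k - c) :
    ahD e v₀ v₁ (k + 1) = ahD e₁ v₀ v₁ (k + 1) - c * ahD e₁ v₀ v₁ k := by
  rcases k with _ | j
  · simp [hk]; ring
  · rw [ahD_add_two, ahD_add_two, hk, ahD_congr v₀ v₁ (j + 1) hlt,
      ahD_congr v₀ v₁ j (fun i hi => hlt i (by omega))]
    ring

/-- `D_n` commutes with complexification. [folklore] -/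
theorem ahD_ofReal (d : ℕ → ℝ) (v₀ v₁ : ℝ) :
    ∀ n, ahD (fun j => (d j : ℂ)) (v₀ : ℂ) (v₁ : ℂ) n = ((ahD d v₀ v₁ n : ℝ) : ℂ)
  | 0 => rfl
  | 1 => by simp
  | n + 2 => by
    rw [ahD_add_two, ahD_add_two, ahD_ofReal d v₀ v₁ (n + 1), ahD_ofReal d v₀ v₁ n]
    push_cast
    ring

/-- `D_n(e₁)` commutes with complexification. [folklore] -/
theorem ahD_ofReal₁₀ (d : ℕ → ℝ) (n : ℕ) :
    ahD (fun j => (d j : ℂ)) 1 0 n = ((ahD d 1 0 n : ℝ) : ℂ) := by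
  simpa using ahD_ofReal d 1 0 n

/-- `D_n(e₂)` commutes with complexification. [folklore] -/
theorem ahD_ofReal₀₁ (d : ℕ → ℝ) (n : ℕ) :
    ahD (fun j => (d j : ℂ)) 0 1 n = ((ahD d 0 1 n : ℝ) : ℂ) := by
  simpa using ahD_ofReal d 0 1 n

/-- Entries of the Dirichlet force matrix `Φ_D` (Hessian of `½∑_{k=0}^n (q_{k+1} - q_k)²`, walls
`q_0 = q_{n+1} = 0`): `2` on the diagonal, `-1` on the two off-diagonals.
[cite: AjankiHuveneers2011, §1.1 eq. (1.3)] -/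
theorem clForceMatrix_apply {n : ℕ} (a b : Fin n) :
    (clForceMatrix n : Matrix (Fin n) (Fin n) R) a b =
      if a = b then 2 else if a.val + 1 = b.val ∨ b.val + 1 = a.val then -1 else 0 := by
  classical
  have h1 : (clForceMatrix n : Matrix (Fin n) (Fin n) R) a b =
      ((clForceMatrix n : Matrix (Fin n) (Fin n) R) *ᵥ Pi.single b 1) a := by
    rw [Matrix.mulVec_single_one, Matrix.col_apply]
  rw [h1, clForceMatrix_mulVec_apply, forceMatrix_mulVec_apply_eq]
  simp only [zero_mul, zero_add, bathMult, Pi.single_apply, Fin.ext_iff]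
  rcases a with ⟨a, ha⟩
  rcases b with ⟨b, hb⟩
  simp only
  split_ifs <;> first | (exfalso; omega) | ring1

/-- `Φ_D = triDiag 2`. [cite: AjankiHuveneers2011, §1.1 eq. (1.3)] -/
theorem clForceMatrix_eq_triDiag (n : ℕ) :
    (clForceMatrix n : Matrix (Fin n) (Fin n) R) = triDiag fun _ => (2 : R) := by
  ext a b
  rw [clForceMatrix_apply, triDiag_apply]

/-- Subtracting a diagonal matrix from a tridiagonal one. [folklore] -/
theorem triDiag_sub_diagonal {n : ℕ} (z w : Fin n → R) :
    triDiag z - Matrix.diagonal w = triDiag (z - w) := by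
  ext i j
  simp only [Matrix.sub_apply, triDiag_apply, Matrix.diagonal_apply, Pi.sub_apply]
  split_ifs <;> ring

end ChainEntries

/-- The impedance matrix is tridiagonal with diagonal `2 - m_kω² - iωλm_k([k=1]+[k=n])`.
[cite: Dhar2008, §3.4.1] -/
theorem clImpedance_eq_triDiag {n : ℕ} (m : Fin n → ℝ) (lam ω : ℝ) :
    clImpedance m lam ω = triDiag fun i =>
      (2 : ℂ) - ((m i : ℂ) * (ω : ℂ) ^ 2 + Complex.I * ω * lam * m i * bathMult n i) := by
  rw [clImpedance, clForceMatrix_eq_triDiag, triDiag_sub_diagonal]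
  rfl

/-- The diagonal symbol `d_k(ω) = 2 - m_kω²` of Dhar's transfer matrices
`T̂_k = [[2 - m_kω², -1],[1,0]]` (= `A_k(w)` of AH2011 eq. (2.1) in the physical frequency),
extended by `0` beyond the chain. [cite: Dhar2008, §3.4.1] [cite: AjankiHuveneers2011, §2 eq. (2.1)] -/
def massDiag {n : ℕ} (m : Fin n → ℝ) (ω : ℝ) : ℕ → ℝ :=
  finExt fun i => 2 - m i * ω ^ 2

/-- `D_j(e₁)(ω)` for the chain with masses `m`. [cite: AjankiHuveneers2011, §2.1 eqs. (2.2)-(2.3)] -/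
def chainD₁ {n : ℕ} (m : Fin n → ℝ) (ω : ℝ) (j : ℕ) : ℝ := ahD (massDiag m ω) 1 0 j

/-- `D_j(e₂)(ω)` for the chain with masses `m`. [cite: AjankiHuveneers2011, §2.1 eqs. (2.2)-(2.3)] -/
def chainD₂ {n : ℕ} (m : Fin n → ℝ) (ω : ℝ) (j : ℕ) : ℝ := ahD (massDiag m ω) 0 1 j

/-- **`det Z_n(ω) = v_nᵀ Q_n(ω) v_1`** with `v_1 = e₁ + iλm₁ω e₂`, `v_n = e₁ - iλm_nω e₂`, written
out: `Re = D_n(e₁) + (λm₁ω)(λm_nω) D_{n-1}(e₂)`, `Im = λm₁ω D_n(e₂) - λm_nω D_{n-1}(e₁)` (for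
`n = 1` both baths sit on the single site). This is the identity that turns Dhar's
`𝒯_N = 4Γ²|G_{1N}|²`, `|G_{1N}| = 1/|det Ẑ|` into AH2011's `|v_{μ,n}ᵀ A_n⋯A_1 v_{μ,1}|^{-2}`.
[cite: AjankiHuveneers2011, §1 eq. (1.2) and §2.1 eq. (2.5)] [cite: Dhar2008, §3.4.1] -/
theorem det_clImpedance {k : ℕ} (m : Fin (k + 1) → ℝ) (lam ω : ℝ) :
    (clImpedance m lam ω).det =
      ((chainD₁ m ω (k + 1) + (ω * lam * m 0) * (ω * lam * m (Fin.last k)) * chainD₂ m ω k : ℝ) : ℂ) +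
        ((ω * lam * m 0 * chainD₂ m ω (k + 1) - ω * lam * m (Fin.last k) * chainD₁ m ω k : ℝ) : ℂ) *
          Complex.I := by
  rw [clImpedance_eq_triDiag, det_triDiag]
  set α : ℝ := ω * lam * m 0 with hα
  set β : ℝ := ω * lam * m (Fin.last k) with hβ
  set z : Fin (k + 1) → ℂ := fun i => (2 : ℂ) - ((m i : ℂ) * (ω : ℂ) ^ 2 +
    Complex.I * ω * lam * m i * bathMult (k + 1) i) with hz
  set dC : ℕ → ℂ := fun j => ((massDiag m ω j : ℝ) : ℂ) with hdC
  set e₁ : ℕ → ℂ := fun j => if j = 0 then dC 0 - Complex.I * α else dC j with he₁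
  have hval : ∀ (j : ℕ) (hj : j < k + 1), finExt z j =
      (2 : ℂ) - ((m ⟨j, hj⟩ : ℂ) * (ω : ℂ) ^ 2 + Complex.I * ω * lam * m ⟨j, hj⟩ *
        ((if j = 0 then 1 else 0) + (if j = k then 1 else 0))) := by
    intro j hj
    rw [finExt_of_lt _ hj, hz]
    simp only [bathMult, Nat.add_sub_cancel]
  have hd : ∀ (j : ℕ) (hj : j < k + 1), dC j = (2 : ℂ) - (m ⟨j, hj⟩ : ℂ) * (ω : ℂ) ^ 2 := by
    intro j hj
    rw [hdC]
    simp only [massDiag, finExt_of_lt _ hj]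
    push_cast
    ring
  have h0 : ((⟨0, Nat.succ_pos k⟩ : Fin (k + 1))) = 0 := rfl
  have hK : ((⟨k, Nat.lt_succ_self k⟩ : Fin (k + 1))) = Fin.last k := rfl
  have hlt : ∀ j, j < k → finExt z j = e₁ j := by
    intro j hj
    rw [hval j (by omega), he₁]
    by_cases hj0 : j = 0
    · subst hj0
      simp only [if_true]
      rw [if_neg (by omega), hd 0 (by omega), h0, hα]
      push_cast
      ring
    · simp only [if_neg hj0]
      rw [if_neg (by omega), hd j (by omega)]
      ring
  have hk : finExt z k = e₁ k - Complex.I * β := by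
    rw [hval k (by omega), he₁, hK, hβ]
    by_cases hk0 : k = 0
    · subst hk0
      simp only [if_true]
      rw [hd 0 (by omega), h0, hα, show Fin.last 0 = 0 from rfl]
      push_cast
      ring
    · simp only [if_neg hk0, if_true]
      rw [hd k (by omega), hK]
      push_cast
      ring
  rw [ahD_sub_at_last 1 0 hlt hk]
  have he : ∀ j, ahD e₁ 1 0 j = ahD dC 1 (0 + Complex.I * α * 1) j := by
    intro j
    rw [he₁]
    exact ahD_sub_at_zero dC _ 1 0 j
  rw [he, he, ahD_eq_lin dC 1 _ (k + 1), ahD_eq_lin dC 1 _ k, hdC, ahD_ofReal₁₀, ahD_ofReal₁₀,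
    ahD_ofReal₀₁, ahD_ofReal₀₁]
  simp only [chainD₁, chainD₂, hα, hβ]
  push_cast
  ring_nf
  rw [Complex.I_sq]
  ring

/-- `|det Z_n(ω)|²` in terms of the transfer-matrix elements. [cite: AjankiHuveneers2011, §2.1 eqs. (2.5)-(2.7)] -/
theorem normSq_det_clImpedance {k : ℕ} (m : Fin (k + 1) → ℝ) (lam ω : ℝ) :
    Complex.normSq (clImpedance m lam ω).det =
      (chainD₁ m ω (k + 1) + (ω * lam * m 0) * (ω * lam * m (Fin.last k)) * chainD₂ m ω k) ^ 2 +
        (ω * lam * m 0 * chainD₂ m ω (k + 1) - ω * lam * m (Fin.last k) * chainD₁ m ω k) ^ 2 := by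
  rw [det_clImpedance, Complex.normSq_add_mul_I]

/-- `det Q_n = 1` for the chain: `D_{k+1}(e₁) D_k(e₂) - D_k(e₁) D_{k+1}(e₂) = 1`.
[cite: AjankiHuveneers2011, §2.1 (before eq. (2.7))] -/
theorem chainD_casorati {n : ℕ} (m : Fin n → ℝ) (ω : ℝ) (k : ℕ) :
    chainD₁ m ω (k + 1) * chainD₂ m ω k - chainD₁ m ω k * chainD₂ m ω (k + 1) = 1 :=
  ahD_casorati _ k

/-- **The current density `j_n`** of AH2011 eq. (2.7) in the physical frequency `ω` of
`clImpedance`: `j_n(ω; m) = |v_nᵀ Q_n(ω) v_1|^{-2}` for the normalised bath vectors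
`v_1 = ω^{-1/2}e₁ + iω^{1/2}e₂`, `v_n = ω^{-1/2}e₁ - iω^{1/2}e₂`, i.e. (expanding with `det Q_n = 1`
to remove the mixed terms) `(2 + ω⁻²D_n(e₁)² + D_{n-1}(e₁)² + D_n(e₂)² + ω²D_{n-1}(e₂)²)⁻¹`,
written as `ω²/(2ω² + D_n(e₁)² + ω²(D_{n-1}(e₁)² + D_n(e₂)²) + ω⁴D_{n-1}(e₂)²)` so that no division
by `ω` occurs (`0/0 = 0` never happens for `ω ≠ 0`; at `ω = 0` the value is `0`); `0` for the
empty chain. The paper prints the bracket with `1 +`; its `w` is the fixed multiple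
`ω√(𝔼M)/π` of `ω` and its `A_k(w)` is `T_k(ω)`, so all `≲`-statements transfer with constants
depending on `𝔼M ∈ [a, b]`. [cite: AjankiHuveneers2011, §2.1 eqs. (2.6)-(2.7)] -/
def clCurrentDensity : {n : ℕ} → (Fin n → ℝ) → ℝ → ℝ
  | 0, _, _ => 0
  | k + 1, m, ω => ω ^ 2 / (2 * ω ^ 2 + chainD₁ m ω (k + 1) ^ 2 +
      ω ^ 2 * (chainD₁ m ω k ^ 2 + chainD₂ m ω (k + 1) ^ 2) + ω ^ 4 * chainD₂ m ω k ^ 2)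

/-- Unfolding `j_n` for a non-empty chain. [cite: AjankiHuveneers2011, §2.1 eq. (2.7)] -/
theorem clCurrentDensity_succ {k : ℕ} (m : Fin (k + 1) → ℝ) (ω : ℝ) :
    clCurrentDensity m ω = ω ^ 2 / (2 * ω ^ 2 + chainD₁ m ω (k + 1) ^ 2 +
      ω ^ 2 * (chainD₁ m ω k ^ 2 + chainD₂ m ω (k + 1) ^ 2) + ω ^ 4 * chainD₂ m ω k ^ 2) := rfl

/-- `j_n ≥ 0`. [folklore] -/
theorem clCurrentDensity_nonneg {n : ℕ} (m : Fin n → ℝ) (ω : ℝ) : 0 ≤ clCurrentDensity m ω := by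
  rcases n with _ | k
  · exact le_rfl
  · rw [clCurrentDensity_succ]
    positivity

/-- `j_n ≤ 1/2` (the `2` coming from `det Q_n = 1`). [folklore] -/
theorem clCurrentDensity_le_half {n : ℕ} (m : Fin n → ℝ) (ω : ℝ) : clCurrentDensity m ω ≤ 1 / 2 := by
  rcases n with _ | k
  · show (0 : ℝ) ≤ 1 / 2
    norm_num
  · rw [clCurrentDensity_succ]
    rcases eq_or_ne ω 0 with hω | hω
    · subst hω
      simp
    · rw [div_le_div_iff₀ (by positivity) (by norm_num)]
      nlinarith [sq_nonneg (chainD₁ m ω (k + 1)), sq_nonneg ω,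
        mul_nonneg (sq_nonneg ω) (add_nonneg (sq_nonneg (chainD₁ m ω k)) (sq_nonneg (chainD₂ m ω (k + 1)))),
        mul_nonneg (by positivity : (0 : ℝ) ≤ ω ^ 4) (sq_nonneg (chainD₂ m ω k))]

/-- The diagonal symbol is even in `ω`. [folklore] -/
theorem massDiag_neg {n : ℕ} (m : Fin n → ℝ) (ω : ℝ) : massDiag m (-ω) = massDiag m ω := by
  funext j
  simp [massDiag, finExt]

/-- `j_n` is even in `ω` ("the bath vectors are symmetric in `w`").
[cite: AjankiHuveneers2011, §2.1 (before eq. (2.6))] -/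
theorem clCurrentDensity_neg {n : ℕ} (m : Fin n → ℝ) (ω : ℝ) :
    clCurrentDensity m (-ω) = clCurrentDensity m ω := by
  rcases n with _ | k
  · rfl
  · simp only [clCurrentDensity_succ, chainD₁, chainD₂, massDiag_neg]
    ring_nf

/-! continuity -/

section ContinuityD

variable {X : Type*} [TopologicalSpace X]

/-- `D_n(v)` depends continuously on a continuously varying diagonal symbol. [folklore] -/
theorem continuous_ahD {d : X → ℕ → ℝ} (hd : ∀ k, Continuous fun x => d x k) (v₀ v₁ : ℝ) :
    ∀ n, Continuous fun x => ahD (d x) v₀ v₁ n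
  | 0 => continuous_const
  | 1 => by
    simp only [ahD_one]
    fun_prop
  | n + 2 => by
    simp only [ahD_add_two]
    have h1 := continuous_ahD hd v₀ v₁ (n + 1)
    have h2 := continuous_ahD hd v₀ v₁ n
    fun_prop

/-- Joint continuity of `d_k(ω)` in (masses, frequency). [folklore] -/
theorem continuous_massDiag {n : ℕ} (j : ℕ) :
    Continuous fun p : (Fin n → ℝ) × ℝ => massDiag p.1 p.2 j := by
  unfold massDiag finExt
  by_cases hj : j < n
  · simp only [dif_pos hj]
    fun_prop
  · simp only [dif_neg hj]
    exact continuous_const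

/-- Joint continuity of `D_j(e₁)` in (masses, frequency). [folklore] -/
theorem continuous_chainD₁ {n : ℕ} (j : ℕ) :
    Continuous fun p : (Fin n → ℝ) × ℝ => chainD₁ p.1 p.2 j :=
  continuous_ahD (d := fun p : (Fin n → ℝ) × ℝ => massDiag p.1 p.2) continuous_massDiag 1 0 j

/-- Joint continuity of `D_j(e₂)` in (masses, frequency). [folklore] -/
theorem continuous_chainD₂ {n : ℕ} (j : ℕ) :
    Continuous fun p : (Fin n → ℝ) × ℝ => chainD₂ p.1 p.2 j :=
  continuous_ahD (d := fun p : (Fin n → ℝ) × ℝ => massDiag p.1 p.2) continuous_massDiag 0 1 j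

end ContinuityD

/-- Joint measurability of `j_n(ω; m)` in (masses, frequency). [folklore] -/
theorem measurable_clCurrentDensity (n : ℕ) :
    Measurable fun p : (Fin n → ℝ) × ℝ => clCurrentDensity p.1 p.2 := by
  rcases n with _ | k
  · exact measurable_const
  · simp only [clCurrentDensity_succ]
    refine Measurable.div (by fun_prop) ?_
    have h1 := continuous_chainD₁ (n := k + 1) (k + 1)
    have h2 := continuous_chainD₁ (n := k + 1) k
    have h3 := continuous_chainD₂ (n := k + 1) (k + 1)
    have h4 := continuous_chainD₂ (n := k + 1) k
    exact (by fun_prop : Continuous fun p : (Fin (k + 1) → ℝ) × ℝ => 2 * p.2 ^ 2 +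
      chainD₁ p.1 p.2 (k + 1) ^ 2 + p.2 ^ 2 * (chainD₁ p.1 p.2 k ^ 2 + chainD₂ p.1 p.2 (k + 1) ^ 2) +
      p.2 ^ 4 * chainD₂ p.1 p.2 k ^ 2).measurable

/-- Measurability of `ω ↦ j_n(ω; m)`. [folklore] -/
theorem measurable_clCurrentDensity_right {n : ℕ} (m : Fin n → ℝ) :
    Measurable fun ω => clCurrentDensity m ω :=
  (measurable_clCurrentDensity n).comp (measurable_const.prodMk measurable_id)

/-- Joint measurability of the transmission integrand `ω²/|det Z_n(ω)|²`. [folklore] -/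
theorem measurable_clSpectralIntegrand (k : ℕ) (lam : ℝ) :
    Measurable fun p : (Fin (k + 1) → ℝ) × ℝ =>
      p.2 ^ 2 / Complex.normSq (clImpedance p.1 lam p.2).det := by
  simp only [normSq_det_clImpedance]
  refine Measurable.div (by fun_prop) ?_
  have h1 := continuous_chainD₁ (n := k + 1) (k + 1)
  have h2 := continuous_chainD₁ (n := k + 1) k
  have h3 := continuous_chainD₂ (n := k + 1) (k + 1)
  have h4 := continuous_chainD₂ (n := k + 1) k
  have h5 : Continuous fun p : (Fin (k + 1) → ℝ) × ℝ => p.1 0 := by fun_prop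
  have h6 : Continuous fun p : (Fin (k + 1) → ℝ) × ℝ => p.1 (Fin.last k) := by fun_prop
  exact (by fun_prop : Continuous fun p : (Fin (k + 1) → ℝ) × ℝ =>
    (chainD₁ p.1 p.2 (k + 1) + (p.2 * lam * p.1 0) * (p.2 * lam * p.1 (Fin.last k)) * chainD₂ p.1 p.2 k) ^ 2 +
      (p.2 * lam * p.1 0 * chainD₂ p.1 p.2 (k + 1) - p.2 * lam * p.1 (Fin.last k) * chainD₁ p.1 p.2 k) ^ 2).measurable

/-- Measurability of `ω ↦ ω²/|det Z_n(ω)|²`. [folklore] -/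
theorem measurable_clSpectralIntegrand_right {k : ℕ} (m : Fin (k + 1) → ℝ) (lam : ℝ) :
    Measurable fun ω : ℝ => ω ^ 2 / Complex.normSq (clImpedance m lam ω).det :=
  (measurable_clSpectralIntegrand k lam).comp (measurable_const.prodMk measurable_id)

/-! ### Comparison of the transmission integrand with the current density -/

/-- Lower comparison constant `λ²a²/max(1, λ²b², λ⁴b⁴)` between the transmission integrand and
`j_n` for masses in `[a, b]`. [folklore] -/
def cmpLo (lam a b : ℝ) : ℝ :=
  lam ^ 2 * a ^ 2 / max 1 (max (lam ^ 2 * b ^ 2) ((lam ^ 2 * b ^ 2) ^ 2))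

/-- Upper comparison constant `λ²b²/min(1, λ²a², λ⁴a⁴)`. [folklore] -/
def cmpHi (lam a b : ℝ) : ℝ :=
  lam ^ 2 * b ^ 2 / min 1 (min (lam ^ 2 * a ^ 2) ((lam ^ 2 * a ^ 2) ^ 2))

/-- `c_lo > 0`. [folklore] -/
theorem cmpLo_pos {lam a : ℝ} (b : ℝ) (hlam : 0 < lam) (ha : 0 < a) : 0 < cmpLo lam a b :=
  div_pos (by positivity) (lt_of_lt_of_le one_pos (le_max_left _ _))

/-- `c_hi > 0`. [folklore] -/
theorem cmpHi_pos {lam a b : ℝ} (hlam : 0 < lam) (ha : 0 < a) (hab : a ≤ b) : 0 < cmpHi lam a b := by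
  have hb : 0 < b := ha.trans_le hab
  exact div_pos (by positivity) (lt_min one_pos (lt_min (by positivity) (by positivity)))

/-- **Pointwise comparison** ("Since the masses have a compact support `[m₋,m₊] ⊂ ]0,∞[` … one
has `|v_{CL,n}ᵀ Q_n v_{CL,1}|^{-2} ∼ j_n`"): for masses in `[a, b] ⊂ (0, ∞)` and `λ > 0`,
`c_lo j_n(ω) ≤ λ²m₁m_nω²/|det Z_n(ω)|² ≤ c_hi j_n(ω)` for every real `ω`; indeed
`λ²m₁m_nω²/|det Z_n|² = (2 + D_n(e₁)²/(αβ) + αβD_{n-1}(e₂)² + (α/β)D_n(e₂)² + (β/α)D_{n-1}(e₁)²)⁻¹`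
with `α = λm₁ω`, `β = λm_nω`. [cite: AjankiHuveneers2011, §2.1 eqs. (2.5)-(2.6)] -/
theorem clSpectralIntegrand_bounds {k : ℕ} {m : Fin (k + 1) → ℝ} {a b lam : ℝ} (hlam : 0 < lam)
    (ha : 0 < a) (hm : ∀ i, a ≤ m i ∧ m i ≤ b) (ω : ℝ) :
    cmpLo lam a b * clCurrentDensity m ω ≤
        lam ^ 2 * m 0 * m (Fin.last k) * (ω ^ 2 / Complex.normSq (clImpedance m lam ω).det) ∧
      lam ^ 2 * m 0 * m (Fin.last k) * (ω ^ 2 / Complex.normSq (clImpedance m lam ω).det) ≤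
        cmpHi lam a b * clCurrentDensity m ω := by
  have hcas := chainD_casorati m ω k
  -- the two denominators
  have hden : Complex.normSq (clImpedance m lam ω).det =
      chainD₁ m ω (k + 1) ^ 2 + (lam ^ 2 * m 0 * m (Fin.last k)) * (2 * ω ^ 2) +
        (lam ^ 2 * m 0 * m (Fin.last k)) ^ 2 * (ω ^ 4 * chainD₂ m ω k ^ 2) +
        (lam * m 0) ^ 2 * (ω ^ 2 * chainD₂ m ω (k + 1) ^ 2) +
        (lam * m (Fin.last k)) ^ 2 * (ω ^ 2 * chainD₁ m ω k ^ 2) := by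
    rw [normSq_det_clImpedance]
    linear_combination (2 * (ω * lam * m 0) * (ω * lam * m (Fin.last k))) * hcas
  set Dj : ℝ := 2 * ω ^ 2 + chainD₁ m ω (k + 1) ^ 2 +
      ω ^ 2 * (chainD₁ m ω k ^ 2 + chainD₂ m ω (k + 1) ^ 2) + ω ^ 4 * chainD₂ m ω k ^ 2 with hDj
  have hj : clCurrentDensity m ω = ω ^ 2 / Dj := rfl
  -- bounds on the coefficients
  have h0 := hm 0
  have hl := hm (Fin.last k)
  have hb : 0 < b := ha.trans_le (h0.1.trans h0.2)
  have hm0 : 0 < m 0 := ha.trans_le h0.1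
  have hml : 0 < m (Fin.last k) := ha.trans_le hl.1
  set s : ℝ := lam ^ 2 * m 0 * m (Fin.last k) with hs
  set p : ℝ := lam ^ 2 * a ^ 2 with hp
  set P : ℝ := lam ^ 2 * b ^ 2 with hP
  have hs_pos : 0 < s := by positivity
  have hps : p ≤ s :=
    calc p = lam ^ 2 * (a * a) := by rw [hp]; ring
      _ ≤ lam ^ 2 * (m 0 * m (Fin.last k)) :=
          mul_le_mul_of_nonneg_left (mul_le_mul h0.1 hl.1 ha.le hm0.le) (by positivity)
      _ = s := by rw [hs]; ring
  have hsP : s ≤ P :=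
    calc s = lam ^ 2 * (m 0 * m (Fin.last k)) := by rw [hs]; ring
      _ ≤ lam ^ 2 * (b * b) :=
          mul_le_mul_of_nonneg_left (mul_le_mul h0.2 hl.2 hml.le hb.le) (by positivity)
      _ = P := by rw [hP]; ring
  have hp0 : p ≤ (lam * m 0) ^ 2 := by
    rw [hp, mul_pow]; exact mul_le_mul_of_nonneg_left (pow_le_pow_left₀ ha.le h0.1 2) (by positivity)
  have h0P : (lam * m 0) ^ 2 ≤ P := by
    rw [hP, mul_pow]; exact mul_le_mul_of_nonneg_left (pow_le_pow_left₀ hm0.le h0.2 2) (by positivity)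
  have hpl : p ≤ (lam * m (Fin.last k)) ^ 2 := by
    rw [hp, mul_pow]; exact mul_le_mul_of_nonneg_left (pow_le_pow_left₀ ha.le hl.1 2) (by positivity)
  have hlP : (lam * m (Fin.last k)) ^ 2 ≤ P := by
    rw [hP, mul_pow]; exact mul_le_mul_of_nonneg_left (pow_le_pow_left₀ hml.le hl.2 2) (by positivity)
  have hp_pos : 0 < p := by positivity
  have hpp : p ^ 2 ≤ s ^ 2 := pow_le_pow_left₀ hp_pos.le hps 2
  have hPP : s ^ 2 ≤ P ^ 2 := pow_le_pow_left₀ hs_pos.le hsP 2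
  set μ : ℝ := min 1 (min p (p ^ 2)) with hμ
  set M : ℝ := max 1 (max P (P ^ 2)) with hM
  have hμ_pos : 0 < μ := lt_min one_pos (lt_min hp_pos (by positivity))
  have hM_pos : 0 < M := lt_of_lt_of_le one_pos (le_max_left _ _)
  have hμ1 : μ ≤ 1 := min_le_left _ _
  have hμs : μ ≤ s := (min_le_right _ _).trans ((min_le_left _ _).trans hps)
  have hμs2 : μ ≤ s ^ 2 := (min_le_right _ _).trans ((min_le_right _ _).trans hpp)
  have hμ0 : μ ≤ (lam * m 0) ^ 2 := (min_le_right _ _).trans ((min_le_left _ _).trans hp0)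
  have hμl : μ ≤ (lam * m (Fin.last k)) ^ 2 := (min_le_right _ _).trans ((min_le_left _ _).trans hpl)
  have hM1 : 1 ≤ M := le_max_left _ _
  have hMs : s ≤ M := hsP.trans ((le_max_left _ _).trans (le_max_right _ _))
  have hMs2 : s ^ 2 ≤ M := hPP.trans ((le_max_right _ _).trans (le_max_right _ _))
  have hM0 : (lam * m 0) ^ 2 ≤ M := h0P.trans ((le_max_left _ _).trans (le_max_right _ _))
  have hMl : (lam * m (Fin.last k)) ^ 2 ≤ M := hlP.trans ((le_max_left _ _).trans (le_max_right _ _))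
  -- nonnegativity of the terms
  have t1 : 0 ≤ chainD₁ m ω (k + 1) ^ 2 := sq_nonneg _
  have t2 : 0 ≤ 2 * ω ^ 2 := by positivity
  have t3 : 0 ≤ ω ^ 4 * chainD₂ m ω k ^ 2 := by positivity
  have t4 : 0 ≤ ω ^ 2 * chainD₂ m ω (k + 1) ^ 2 := by positivity
  have t5 : 0 ≤ ω ^ 2 * chainD₁ m ω k ^ 2 := by positivity
  have hDg_le : Complex.normSq (clImpedance m lam ω).det ≤ M * Dj :=
    calc Complex.normSq (clImpedance m lam ω).det
        = 1 * chainD₁ m ω (k + 1) ^ 2 + s * (2 * ω ^ 2) + s ^ 2 * (ω ^ 4 * chainD₂ m ω k ^ 2) +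
            (lam * m 0) ^ 2 * (ω ^ 2 * chainD₂ m ω (k + 1) ^ 2) +
            (lam * m (Fin.last k)) ^ 2 * (ω ^ 2 * chainD₁ m ω k ^ 2) := by rw [hden, one_mul]
      _ ≤ M * chainD₁ m ω (k + 1) ^ 2 + M * (2 * ω ^ 2) + M * (ω ^ 4 * chainD₂ m ω k ^ 2) +
            M * (ω ^ 2 * chainD₂ m ω (k + 1) ^ 2) + M * (ω ^ 2 * chainD₁ m ω k ^ 2) := by
          gcongr
      _ = M * Dj := by rw [hDj]; ring
  have hDg_ge : μ * Dj ≤ Complex.normSq (clImpedance m lam ω).det :=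
    calc μ * Dj = μ * chainD₁ m ω (k + 1) ^ 2 + μ * (2 * ω ^ 2) + μ * (ω ^ 4 * chainD₂ m ω k ^ 2) +
            μ * (ω ^ 2 * chainD₂ m ω (k + 1) ^ 2) + μ * (ω ^ 2 * chainD₁ m ω k ^ 2) := by
          rw [hDj]; ring
      _ ≤ 1 * chainD₁ m ω (k + 1) ^ 2 + s * (2 * ω ^ 2) + s ^ 2 * (ω ^ 4 * chainD₂ m ω k ^ 2) +
            (lam * m 0) ^ 2 * (ω ^ 2 * chainD₂ m ω (k + 1) ^ 2) +
            (lam * m (Fin.last k)) ^ 2 * (ω ^ 2 * chainD₁ m ω k ^ 2) := by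
          gcongr
      _ = Complex.normSq (clImpedance m lam ω).det := by rw [hden, one_mul]
  have hLo : cmpLo lam a b = p / M := rfl
  have hHi : cmpHi lam a b = P / μ := rfl
  rw [hj, hLo, hHi]
  rcases eq_or_ne ω 0 with hω | hω
  · subst hω
    simp
  have hDj_pos : 0 < Dj := by rw [hDj]; positivity
  have hDg_pos : 0 < Complex.normSq (clImpedance m lam ω).det :=
    lt_of_lt_of_le (mul_pos hμ_pos hDj_pos) hDg_ge
  constructor
  · rw [div_mul_div_comm, ← mul_div_assoc, div_le_div_iff₀ (by positivity) hDg_pos]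
    calc p * ω ^ 2 * Complex.normSq (clImpedance m lam ω).det
        ≤ s * ω ^ 2 * (M * Dj) :=
          mul_le_mul (mul_le_mul_of_nonneg_right hps (sq_nonneg ω)) hDg_le hDg_pos.le (by positivity)
      _ = s * ω ^ 2 * (M * Dj) := rfl
  · rw [div_mul_div_comm, ← mul_div_assoc, div_le_div_iff₀ hDg_pos (by positivity)]
    calc s * ω ^ 2 * (μ * Dj) ≤ P * ω ^ 2 * Complex.normSq (clImpedance m lam ω).det :=
          mul_le_mul (mul_le_mul_of_nonneg_right hsP (sq_nonneg ω)) hDg_ge (by positivity) (by positivity)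
      _ = P * ω ^ 2 * Complex.normSq (clImpedance m lam ω).det := rfl

/-- Unfolding `clSpectralConductance` for a non-empty chain. [folklore] -/
theorem clSpectralConductance_succ {k : ℕ} (m : Fin (k + 1) → ℝ) (lam : ℝ) :
    clSpectralConductance m lam = lam ^ 2 * m 0 * m (Fin.last k) / Real.pi *
      ∫ ω : ℝ, ω ^ 2 / Complex.normSq (clImpedance m lam ω).det := rfl

/-- **Integral comparison** (`J^CL_n ∼ ∫ j_n`, eq. (2.6), per unit temperature difference): for
masses in `[a, b] ⊂ (0, ∞)` and `λ > 0`, `(c_lo/π)∫_ℝ j_n ≤ 𝒢_n(m, λ) ≤ (c_hi/π)∫_ℝ j_n` (both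
sides carry the same Bochner junk `0` when `j_n(·; m)` is not integrable, the two integrands
being comparable and measurable). [cite: AjankiHuveneers2011, §2.1 eq. (2.6)] -/
theorem clSpectralConductance_bounds {k : ℕ} {m : Fin (k + 1) → ℝ} {a b lam : ℝ} (hlam : 0 < lam)
    (ha : 0 < a) (hm : ∀ i, a ≤ m i ∧ m i ≤ b) :
    cmpLo lam a b / Real.pi * ∫ ω, clCurrentDensity m ω ≤ clSpectralConductance m lam ∧
      clSpectralConductance m lam ≤ cmpHi lam a b / Real.pi * ∫ ω, clCurrentDensity m ω := by
  set g : ℝ → ℝ := fun ω => lam ^ 2 * m 0 * m (Fin.last k) *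
    (ω ^ 2 / Complex.normSq (clImpedance m lam ω).det) with hg
  have hG : clSpectralConductance m lam = 1 / Real.pi * ∫ ω, g ω := by
    rw [clSpectralConductance_succ, hg, integral_const_mul]
    ring
  have hgm : Measurable g := (measurable_clSpectralIntegrand_right m lam).const_mul _
  have hjm : Measurable fun ω => clCurrentDensity m ω := measurable_clCurrentDensity_right m
  have hpt := fun ω => clSpectralIntegrand_bounds hlam ha hm ω
  have hlo := cmpLo_pos b hlam ha
  have hab : a ≤ b := (hm 0).1.trans (hm 0).2
  have hhi := cmpHi_pos hlam ha hab
  have hg0 : ∀ ω, 0 ≤ g ω := fun ω =>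
    le_trans (mul_nonneg hlo.le (clCurrentDensity_nonneg m ω)) (hpt ω).1
  have hπ : 0 < 1 / Real.pi := by positivity
  by_cases hint : Integrable (fun ω => clCurrentDensity m ω)
  · have hgi : Integrable g := by
      refine (hint.const_mul (cmpHi lam a b)).mono' hgm.aestronglyMeasurable
        (ae_of_all _ fun ω => ?_)
      rw [Real.norm_eq_abs, abs_of_nonneg (hg0 ω)]
      exact (hpt ω).2
    rw [hG]
    constructor
    · calc cmpLo lam a b / Real.pi * ∫ ω, clCurrentDensity m ω
          = 1 / Real.pi * ∫ ω, cmpLo lam a b * clCurrentDensity m ω := by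
            rw [integral_const_mul]; ring
        _ ≤ 1 / Real.pi * ∫ ω, g ω :=
            mul_le_mul_of_nonneg_left (integral_mono (hint.const_mul _) hgi fun ω => (hpt ω).1) hπ.le
    · calc 1 / Real.pi * ∫ ω, g ω
          ≤ 1 / Real.pi * ∫ ω, cmpHi lam a b * clCurrentDensity m ω :=
            mul_le_mul_of_nonneg_left (integral_mono hgi (hint.const_mul _) fun ω => (hpt ω).2) hπ.le
        _ = cmpHi lam a b / Real.pi * ∫ ω, clCurrentDensity m ω := by
            rw [integral_const_mul]; ring
  · have hgi : ¬ Integrable g := by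
      intro hgi
      refine hint ((hgi.const_mul (cmpLo lam a b)⁻¹).mono' hjm.aestronglyMeasurable
        (ae_of_all _ fun ω => ?_))
      rw [Real.norm_eq_abs, abs_of_nonneg (clCurrentDensity_nonneg m ω), ← div_eq_inv_mul,
        le_div_iff₀ hlo, mul_comm]
      exact (hpt ω).1
    rw [hG, integral_undef hint, integral_undef hgi]
    simp

/-! ### Mass averages -/

/-- The standing hypothesis of AH2011 on the single-mass density `τ`: it vanishes off a compact
interval `[a, b] ⊂ (0, ∞)`, is non-negative, continuous on `[a, b]`, `C¹` with bounded derivative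
on `(a, b)`, and has total mass `1` (Thm 1.1: "compactly supported on `]0,∞[`, continuously
differentiable inside its support, with an uniformly bounded derivative"; §2: `τ ∈ C¹([b₋, b₊])`).
The same telescope of hypotheses as in `AjankiHuveneers2011_scaling`, bundled.
[cite: AjankiHuveneers2011, Thm 1.1 and §2] -/
structure MassDensityHyp (τ : ℝ → ℝ) (a b : ℝ) : Prop where
  /-- the support interval lies in `(0, ∞)` -/
  pos : 0 < a
  /-- the support interval is non-degenerate -/
  lt : a < b
  /-- `τ ≥ 0` -/
  nonneg : ∀ s, 0 ≤ τ s
  /-- `τ` vanishes off `[a, b]` -/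
  eq_zero : ∀ s ∉ Set.Icc a b, τ s = 0
  /-- `τ` is continuous on `[a, b]` -/
  continuousOn : ContinuousOn τ (Set.Icc a b)
  /-- `τ` is `C¹` inside its support -/
  contDiffOn : ContDiffOn ℝ 1 τ (Set.Ioo a b)
  /-- with a uniformly bounded derivative -/
  deriv_bound : ∃ C : ℝ, ∀ s ∈ Set.Ioo a b, |deriv τ s| ≤ C
  /-- `τ` is a probability density -/
  integral_eq_one : ∫ s, τ s = 1

/-- The mass-averaged current density `𝔼 j_n(ω) = ∫ j_n(ω; m) ρ^{⊗n}(dm)`.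
[cite: AjankiHuveneers2011, §2.2 eq. (2.8) and §6] -/
def clAvgCurrentDensity (ρ : Measure ℝ) (n : ℕ) (ω : ℝ) : ℝ :=
  ∫ m, clCurrentDensity m ω ∂(Measure.pi fun _ : Fin n => ρ)

/-- `𝔼 j_n ≥ 0`. [folklore] -/
theorem clAvgCurrentDensity_nonneg (ρ : Measure ℝ) (n : ℕ) (ω : ℝ) :
    0 ≤ clAvgCurrentDensity ρ n ω :=
  integral_nonneg fun m => clCurrentDensity_nonneg m ω

/-- `𝔼 j_n ≤ 1/2`. [folklore] -/
theorem clAvgCurrentDensity_le_half (ρ : Measure ℝ) [IsProbabilityMeasure ρ] (n : ℕ) (ω : ℝ) :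
    clAvgCurrentDensity ρ n ω ≤ 1 / 2 := by
  unfold clAvgCurrentDensity
  calc ∫ m, clCurrentDensity m ω ∂(Measure.pi fun _ : Fin n => ρ)
      ≤ ∫ _m, (1 / 2 : ℝ) ∂(Measure.pi fun _ : Fin n => ρ) := by
        refine integral_mono_of_nonneg (ae_of_all _ fun m => clCurrentDensity_nonneg m ω)
          (integrable_const _) (ae_of_all _ fun m => clCurrentDensity_le_half m ω)
    _ = 1 / 2 := by simp

/-- `𝔼 j_n` is even in `ω`. [folklore] -/
theorem clAvgCurrentDensity_neg (ρ : Measure ℝ) (n : ℕ) (ω : ℝ) :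
    clAvgCurrentDensity ρ n (-ω) = clAvgCurrentDensity ρ n ω := by
  simp only [clAvgCurrentDensity, clCurrentDensity_neg]

/-- `𝔼 j_n(|ω|) = 𝔼 j_n(ω)`. [folklore] -/
theorem clAvgCurrentDensity_abs (ρ : Measure ℝ) (n : ℕ) (ω : ℝ) :
    clAvgCurrentDensity ρ n |ω| = clAvgCurrentDensity ρ n ω := by
  rcases le_or_gt 0 ω with h | h
  · rw [abs_of_nonneg h]
  · rw [abs_of_neg h, clAvgCurrentDensity_neg]

/-- `𝔼 j_n` is measurable in `ω`. [folklore] -/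
theorem stronglyMeasurable_clAvgCurrentDensity (ρ : Measure ℝ) [IsProbabilityMeasure ρ] (n : ℕ) :
    StronglyMeasurable (clAvgCurrentDensity ρ n) :=
  (measurable_clCurrentDensity n).stronglyMeasurable.integral_prod_left'
    (μ := Measure.pi fun _ : Fin n => ρ)

/-- For fixed `ω`, `m ↦ j_n(ω; m)` is integrable (bounded by `1/2`). [folklore] -/
theorem integrable_clCurrentDensity_left (ρ : Measure ℝ) [IsProbabilityMeasure ρ] (n : ℕ) (ω : ℝ) :
    Integrable (fun m => clCurrentDensity m ω) (Measure.pi fun _ : Fin n => ρ) := by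
  refine Integrable.mono' (integrable_const (1 / 2 : ℝ))
    ((measurable_clCurrentDensity n).comp (measurable_id.prodMk measurable_const)).aestronglyMeasurable
    (ae_of_all _ fun m => ?_)
  rw [Real.norm_eq_abs, abs_of_nonneg (clCurrentDensity_nonneg m ω)]
  exact clCurrentDensity_le_half m ω

/-- `𝔼 j_n` is integrable on every frequency set of finite measure. [folklore] -/
theorem integrableOn_clAvgCurrentDensity (ρ : Measure ℝ) [IsProbabilityMeasure ρ] (n : ℕ)
    {S : Set ℝ} (hS : volume S ≠ ⊤) : IntegrableOn (clAvgCurrentDensity ρ n) S := by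
  refine Measure.integrableOn_of_bounded hS
    (stronglyMeasurable_clAvgCurrentDensity ρ n).aestronglyMeasurable (M := 1 / 2)
    (ae_of_all _ fun ω => ?_)
  rw [Real.norm_eq_abs, abs_of_nonneg (clAvgCurrentDensity_nonneg ρ n ω)]
  exact clAvgCurrentDensity_le_half ρ n ω

/-! ### Plumbing for the assembly: a.e. masses, Fubini, measurability -/

/-- Under the density hypothesis the masses lie in `[a, b]` almost surely. [folklore] -/
theorem ae_pi_mem_Icc {τ : ℝ → ℝ} {a b : ℝ} (hoff : ∀ s ∉ Set.Icc a b, τ s = 0)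
    {ρ : Measure ℝ} [IsProbabilityMeasure ρ]
    (hρ : ρ = volume.withDensity fun s => ENNReal.ofReal (τ s)) (n : ℕ) :
    ∀ᵐ m ∂(Measure.pi fun _ : Fin n => ρ), ∀ i, a ≤ m i ∧ m i ≤ b := by
  have hρ0 : ρ (Set.Icc a b)ᶜ = 0 := by
    rw [hρ, withDensity_apply _ measurableSet_Icc.compl]
    have : ∀ s ∈ (Set.Icc a b)ᶜ, ENNReal.ofReal (τ s) = 0 := fun s hs => by
      rw [hoff s hs, ENNReal.ofReal_zero]
    rw [setLIntegral_congr_fun measurableSet_Icc.compl this, lintegral_zero]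
  have hae1 : ∀ᵐ s ∂ρ, s ∈ Set.Icc a b := by
    rw [ae_iff]
    exact hρ0
  rw [ae_all_iff]
  intro i
  exact ((measurePreserving_eval (fun _ : Fin n => ρ) i).quasiMeasurePreserving.ae hae1).mono
    fun m hm => hm

/-- Fubini input: `(m, ω) ↦ j_n(ω; m)` is integrable on `ρ^{⊗n} ⊗ ν` as soon as `𝔼 j_n` is
`ν`-integrable. [folklore] -/
theorem integrable_prod_clCurrentDensity (ρ : Measure ℝ) [IsProbabilityMeasure ρ] (n : ℕ)
    (ν : Measure ℝ) [SFinite ν] (hE : Integrable (clAvgCurrentDensity ρ n) ν) :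
    Integrable (fun p : (Fin n → ℝ) × ℝ => clCurrentDensity p.1 p.2)
      ((Measure.pi fun _ : Fin n => ρ).prod ν) := by
  rw [integrable_prod_iff' (measurable_clCurrentDensity n).aestronglyMeasurable]
  refine ⟨ae_of_all _ fun ω => integrable_clCurrentDensity_left ρ n ω, hE.congr (ae_of_all _ fun ω => ?_)⟩
  simp only [clAvgCurrentDensity]
  refine integral_congr_ae (ae_of_all _ fun m => ?_)
  show clCurrentDensity m ω = ‖clCurrentDensity m ω‖
  rw [Real.norm_eq_abs, abs_of_nonneg (clCurrentDensity_nonneg m ω)]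

/-- `m ↦ 𝒢_n(m, λ)` is measurable (a parametric Bochner integral of a jointly measurable
integrand). [folklore] -/
theorem stronglyMeasurable_clSpectralConductance (k : ℕ) (lam : ℝ) :
    StronglyMeasurable fun m : Fin (k + 1) → ℝ => clSpectralConductance m lam := by
  have h1 : StronglyMeasurable fun m : Fin (k + 1) → ℝ =>
      ∫ ω : ℝ, ω ^ 2 / Complex.normSq (clImpedance m lam ω).det :=
    (measurable_clSpectralIntegrand k lam).stronglyMeasurable.integral_prod_right' (ν := volume)
  have h2 : Measurable fun m : Fin (k + 1) → ℝ => lam ^ 2 * m 0 * m (Fin.last k) / Real.pi := by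
    fun_prop
  exact h2.stronglyMeasurable.mul h1

/-- The even function `𝔼 j_n` is integrable on `ℝ` once it is integrable on `(0, ∞)`. [folklore] -/
theorem integrable_clAvgCurrentDensity_of_Ioi (ρ : Measure ℝ) [IsProbabilityMeasure ρ] (n : ℕ)
    (h : IntegrableOn (clAvgCurrentDensity ρ n) (Set.Ioi 0)) :
    Integrable (clAvgCurrentDensity ρ n) := by
  have hIic : IntegrableOn (clAvgCurrentDensity ρ n) (Set.Iic 0) := by
    rw [← Measure.map_neg_eq_self (volume : Measure ℝ)]
    let e : MeasurableEmbedding fun x : ℝ => -x := (Homeomorph.neg ℝ).measurableEmbedding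
    rw [e.integrableOn_map_iff]
    simp_rw [Function.comp_def, clAvgCurrentDensity_neg, Set.neg_preimage, Set.neg_Iic, neg_zero]
    exact (integrableOn_Ici_iff_integrableOn_Ioi).mpr h
  have := integrableOn_union.mpr ⟨hIic, h⟩
  rwa [Set.Iic_union_Ioi, integrableOn_univ] at this

/-- **Upper half of the assembly**: integrability of `m ↦ 𝒢_n(m, λ)` and
`∫ 𝒢_n dρ^{⊗n} ≤ (c_hi/π) · 2∫_0^∞ 𝔼 j_n` (`𝔼J^CL_n ≲ 𝔼∫_0^∞ j_n`).
[cite: AjankiHuveneers2011, §2.1 eq. (2.6) and §6.2 eq. (6.4)] -/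
theorem integral_clSpectralConductance_le {k : ℕ} {a b lam : ℝ} (hlam : 0 < lam) (ha : 0 < a)
    (ρ : Measure ℝ) [IsProbabilityMeasure ρ]
    (hae : ∀ᵐ m ∂(Measure.pi fun _ : Fin (k + 1) => ρ), ∀ i, a ≤ m i ∧ m i ≤ b)
    (hE : Integrable (clAvgCurrentDensity ρ (k + 1))) :
    Integrable (fun m => clSpectralConductance m lam) (Measure.pi fun _ : Fin (k + 1) => ρ) ∧
      ∫ m, clSpectralConductance m lam ∂(Measure.pi fun _ : Fin (k + 1) => ρ) ≤
        cmpHi lam a b / Real.pi * (2 * ∫ ω in Set.Ioi 0, clAvgCurrentDensity ρ (k + 1) ω) := by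
  set μn : Measure (Fin (k + 1) → ℝ) := Measure.pi fun _ : Fin (k + 1) => ρ with hμn
  have hF := integrable_prod_clCurrentDensity ρ (k + 1) volume hE
  have hI : Integrable (fun m : Fin (k + 1) → ℝ => ∫ ω, clCurrentDensity m ω) μn :=
    hF.integral_prod_left
  have hbd : ∀ᵐ m ∂μn, 0 ≤ clSpectralConductance m lam ∧
      clSpectralConductance m lam ≤ cmpHi lam a b / Real.pi * ∫ ω, clCurrentDensity m ω :=
    hae.mono fun m hm => by
      obtain ⟨h1, h2⟩ := clSpectralConductance_bounds hlam ha hm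
      exact ⟨le_trans (mul_nonneg (div_nonneg (cmpLo_pos b hlam ha).le Real.pi_pos.le)
        (integral_nonneg fun ω => clCurrentDensity_nonneg m ω)) h1, h2⟩
  have hInt : Integrable (fun m => clSpectralConductance m lam) μn := by
    refine (hI.const_mul (cmpHi lam a b / Real.pi)).mono'
      (stronglyMeasurable_clSpectralConductance k lam).aestronglyMeasurable (hbd.mono fun m hm => ?_)
    rw [Real.norm_eq_abs, abs_of_nonneg hm.1]
    exact hm.2
  refine ⟨hInt, ?_⟩
  have hswap : ∫ m, (∫ ω, clCurrentDensity m ω) ∂μn = ∫ ω, clAvgCurrentDensity ρ (k + 1) ω :=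
    integral_integral_swap (f := fun (m : Fin (k + 1) → ℝ) (ω : ℝ) => clCurrentDensity m ω) hF
  have habs : ∫ ω, clAvgCurrentDensity ρ (k + 1) ω = 2 * ∫ ω in Set.Ioi 0, clAvgCurrentDensity ρ (k + 1) ω := by
    rw [← integral_comp_abs]
    simp only [clAvgCurrentDensity_abs]
  calc ∫ m, clSpectralConductance m lam ∂μn
      ≤ ∫ m, (cmpHi lam a b / Real.pi * ∫ ω, clCurrentDensity m ω) ∂μn :=
        integral_mono_ae hInt (hI.const_mul _) (hbd.mono fun m hm => hm.2)
    _ = cmpHi lam a b / Real.pi * (2 * ∫ ω in Set.Ioi 0, clAvgCurrentDensity ρ (k + 1) ω) := by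
        rw [integral_const_mul, hswap, habs]

/-- **Lower half of the assembly**: `(c_lo/π) ∫_S 𝔼 j_n ≤ ∫ 𝒢_n dρ^{⊗n}` for every frequency
window `S` (`𝔼J^CL_n ≳ ∫_{(2n)^{-1/2}}^{n^{-1/2}} 𝔼 j_n`). [cite: AjankiHuveneers2011, §6.1 eq. (6.2)] -/
theorem setIntegral_le_integral_clSpectralConductance {k : ℕ} {a b lam : ℝ} (hlam : 0 < lam)
    (ha : 0 < a) (ρ : Measure ℝ) [IsProbabilityMeasure ρ]
    (hae : ∀ᵐ m ∂(Measure.pi fun _ : Fin (k + 1) => ρ), ∀ i, a ≤ m i ∧ m i ≤ b)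
    (hE : Integrable (clAvgCurrentDensity ρ (k + 1))) (S : Set ℝ) :
    cmpLo lam a b / Real.pi * ∫ ω in S, clAvgCurrentDensity ρ (k + 1) ω ≤
      ∫ m, clSpectralConductance m lam ∂(Measure.pi fun _ : Fin (k + 1) => ρ) := by
  set μn : Measure (Fin (k + 1) → ℝ) := Measure.pi fun _ : Fin (k + 1) => ρ with hμn
  have hF := integrable_prod_clCurrentDensity ρ (k + 1) volume hE
  have hFS := integrable_prod_clCurrentDensity ρ (k + 1) (volume.restrict S) hE.restrict
  have hI : Integrable (fun m : Fin (k + 1) → ℝ => ∫ ω, clCurrentDensity m ω) μn :=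
    hF.integral_prod_left
  have hIS : Integrable (fun m : Fin (k + 1) → ℝ => ∫ ω in S, clCurrentDensity m ω) μn :=
    hFS.integral_prod_left
  have hswap : ∫ m, (∫ ω in S, clCurrentDensity m ω) ∂μn = ∫ ω in S, clAvgCurrentDensity ρ (k + 1) ω :=
    integral_integral_swap (f := fun (m : Fin (k + 1) → ℝ) (ω : ℝ) => clCurrentDensity m ω) hFS
  have hslice : ∀ᵐ m ∂μn, Integrable (fun ω => clCurrentDensity m ω) volume := hF.prod_right_ae
  obtain ⟨hInt, -⟩ := integral_clSpectralConductance_le hlam ha ρ hae hE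
  calc cmpLo lam a b / Real.pi * ∫ ω in S, clAvgCurrentDensity ρ (k + 1) ω
      = ∫ m, (cmpLo lam a b / Real.pi * ∫ ω in S, clCurrentDensity m ω) ∂μn := by
        rw [integral_const_mul, hswap]
    _ ≤ ∫ m, (cmpLo lam a b / Real.pi * ∫ ω, clCurrentDensity m ω) ∂μn := by
        refine integral_mono_ae (hIS.const_mul _) (hI.const_mul _) (hslice.mono fun m hm => ?_)
        exact mul_le_mul_of_nonneg_left
          (setIntegral_le_integral hm (ae_of_all _ fun ω => clCurrentDensity_nonneg m ω))
          (div_nonneg (cmpLo_pos b hlam ha).le Real.pi_pos.le)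
    _ ≤ ∫ m, clSpectralConductance m lam ∂μn :=
        integral_mono_ae (hI.const_mul _) hInt
          (hae.mono fun m hm => (clSpectralConductance_bounds hlam ha hm).1)

end Literature.Barriers.AtomisticToContinuum.HeatConduction

namespace Literature.Barriers.AtomisticToContinuum

open Literature.MathematicalPhysics.KineticTheory.HeatConduction HeatConduction

/-! ### The three named facts of §6 -/

/-- **(U) Low-frequency upper bound** (AH2011 §6.2, the terms `𝒥₁ + 𝒥₂` of (6.4):
`𝒥₁ ≲ n⁻³` by (6.5) and `𝒥₂ ≲ n^{-3/2}` by (6.9), from Cor. 3.6, Prop. 4.1, Prop. 5.1 and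
Cor. 3.4(i)): under the standing hypothesis on the mass density there is a threshold frequency
`ω₀ > 0` and a constant `C` such that for every `n ≥ 1`,
`∫_0^{ω₀} 𝔼 j_n(ω) dω ≤ C n^{-3/2}`. Stated for `j_n` in the physical frequency
(`clCurrentDensity`; the paper's `w` is a fixed multiple of `ω`, which only changes constants).
[cite: AjankiHuveneers2011, §6.2 eqs. (6.4), (6.5), (6.9)] -/
def AjankiHuveneers2011_lowFrequencyBound : Prop :=
  ∀ (τ : ℝ → ℝ) (a b : ℝ), MassDensityHyp τ a b →
    ∀ (ρ : Measure ℝ) [IsProbabilityMeasure ρ],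
      ρ = volume.withDensity (fun s => ENNReal.ofReal (τ s)) →
      ∃ ω₀ : ℝ, 0 < ω₀ ∧ ∃ C : ℝ, ∀ n : ℕ, 0 < n →
        ∫ ω in Set.Ioc 0 ω₀, clAvgCurrentDensity ρ n ω ≤ C / (n : ℝ) ^ (3 / 2 : ℝ)

/-- **(H) High-frequency bound** (AH2011 §6.2, the term `𝒥₃ = ∫_{w₀}^∞ 𝔼 j_n` of (6.4): "It has
already been shown by O'Connor [O'Connor-75] that `𝒥₃ ≲ e^{-Cn^{1/2}}`"; §2: "O'Connor has shown
(see Theorem 6 and its proof in [O'Connor-75]) that for any reasonable heat baths the frequencies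
above any fixed `w₀ > 0` have exponentially small contribution to the total current … as `n`
grows"): for every `ω₀ > 0` there are `C` and `c > 0` with
`∫_{ω₀}^∞ 𝔼 j_n(ω) dω ≤ C e^{-c√n}` for all `n ≥ 1` (the integral converging). O'Connor's paper
was not re-read (paywalled); vendored as invoked by AH2011.
[cite: AjankiHuveneers2011, §6.2 (after eq. (6.9)) and §2 ¶3] [cite: OConnor1975, Thm 6, as invoked in AjankiHuveneers2011 §2 and §6.2] -/
def AjankiHuveneers2011_highFrequencyBound : Prop :=
  ∀ (τ : ℝ → ℝ) (a b : ℝ), MassDensityHyp τ a b →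
    ∀ (ρ : Measure ℝ) [IsProbabilityMeasure ρ],
      ρ = volume.withDensity (fun s => ENNReal.ofReal (τ s)) →
      ∀ ω₀ : ℝ, 0 < ω₀ → ∃ C c : ℝ, 0 < c ∧ ∀ n : ℕ, 0 < n →
        IntegrableOn (clAvgCurrentDensity ρ n) (Set.Ioi ω₀) ∧
          ∫ ω in Set.Ioi ω₀, clAvgCurrentDensity ρ n ω ≤ C * Real.exp (-(c * Real.sqrt n))

/-- **(L) Lower bound in the critical band** (AH2011 §6.1: "It is therefore enough to show that
when `1/2 ≤ w²n ≤ 1` the bound `𝔼 j_n(w) ≳ w² ∼ n⁻¹` holds", proved there from Cor. 3.6, Lemma 3.7,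
Prop. 5.1 and Lemma 6.1 for `w ≤ w₀`, i.e. for `n` large): there are `κ, c > 0` and `n₀` such
that `𝔼 j_n(ω) ≥ c ω²` for all `n ≥ n₀` and `κ/√(2n) ≤ ω ≤ κ/√n` (`κ` absorbs the fixed rescaling
`w ↔ ω`). [cite: AjankiHuveneers2011, §6.1 eqs. (6.2)-(6.3) and the display before §6.2] -/
def AjankiHuveneers2011_criticalBandLowerBound : Prop :=
  ∀ (τ : ℝ → ℝ) (a b : ℝ), MassDensityHyp τ a b →
    ∀ (ρ : Measure ℝ) [IsProbabilityMeasure ρ],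
      ρ = volume.withDensity (fun s => ENNReal.ofReal (τ s)) →
      ∃ κ : ℝ, 0 < κ ∧ ∃ c : ℝ, 0 < c ∧ ∃ n₀ : ℕ, ∀ n : ℕ, n₀ ≤ n →
        ∀ ω ∈ Set.Icc (κ / Real.sqrt (2 * n)) (κ / Real.sqrt n),
          c * ω ^ 2 ≤ clAvgCurrentDensity ρ n ω

/-! ### The assembly -/

/-- `e^{-x} ≤ 6/x³` for `x > 0`. [folklore] -/
theorem exp_neg_le_six_div_cube {x : ℝ} (hx : 0 < x) : Real.exp (-x) ≤ 6 / x ^ 3 := by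
  have h := Real.pow_div_factorial_le_exp x hx.le 3
  have h6 : ((Nat.factorial 3 : ℕ) : ℝ) = 6 := by norm_num [Nat.factorial]
  rw [h6, div_le_iff₀ (by norm_num : (0 : ℝ) < 6)] at h
  rw [Real.exp_neg, inv_eq_one_div, div_le_div_iff₀ (Real.exp_pos x) (by positivity)]
  linarith

/-- Arithmetic of the critical band: with `t² = 2`,
`c κ³ (1 - 1/t)/2 / s³ = (κ/s - κ/(ts)) · c (κ/(ts))²`. [folklore] -/
theorem band_arith {κ c s t : ℝ} (hs : 0 < s) (ht : 0 < t) (ht2 : t ^ 2 = 2) :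
    c * (κ ^ 3 * (1 - 1 / t) / 2) / (s ^ 2 * s) =
      (κ / s - κ / (t * s)) * (c * (κ / (t * s)) ^ 2) := by
  have ht3 : t ^ 3 = 2 * t := by rw [pow_succ, ht2]
  have hs0 : s ≠ 0 := hs.ne'
  have ht0 : t ≠ 0 := ht.ne'
  have lhs : c * (κ ^ 3 * (1 - 1 / t) / 2) / (s ^ 2 * s) = c * κ ^ 3 * (t - 1) / (2 * t * s ^ 3) := by
    field_simp
  have rhs : (κ / s - κ / (t * s)) * (c * (κ / (t * s)) ^ 2) =
      c * κ ^ 3 * (t - 1) / (t ^ 3 * s ^ 3) := by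
    field_simp
  rw [lhs, rhs, ht3]

/-- **Reduction of `AjankiHuveneers2011_spectralScaling` to the three bounds of §6.**
Given (U) the low-frequency bound `∫_0^{ω₀} 𝔼 j_n ≲ n^{-3/2}`, (H) O'Connor's high-frequency
bound `∫_{ω₀}^∞ 𝔼 j_n ≲ e^{-c√n}` and (L) the critical-band lower bound `𝔼 j_n(ω) ≳ ω²` for
`κ/√(2n) ≤ ω ≤ κ/√n`, the transmission integral obeys `K n^{-3/2} ≤ 𝔼 𝒢_n ≤ K' n^{-3/2}`:
the masses lie in `[a,b]` a.s., so `𝒢_n ≍ ∫_ℝ j_n(·; m)` (`clSpectralConductance_bounds`, i.e.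
AH2011 (1.2)+(2.5)-(2.7) with the PROVED determinant identity `det Z_n = v_nᵀ A_n⋯A_1 v_1`);
Fubini turns `𝔼∫ j_n` into `2∫_0^∞ 𝔼 j_n` (evenness in `ω`), which (U)+(H) bound above by
`≲ n^{-3/2} + e^{-c√n} ≲ n^{-3/2}`, and which is bounded below by the band integral
`∫_{κ/√(2n)}^{κ/√n} c ω² dω ≍ n^{-3/2}` of (L). This is §6 of the paper read backwards from its
three displayed conclusions. [cite: AjankiHuveneers2011, §2.1 eq. (2.6), §6.1 eq. (6.2), §6.2 eq. (6.4)] -/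
theorem AjankiHuveneers2011_spectralScaling_of_bounds
    (hU : AjankiHuveneers2011_lowFrequencyBound) (hH : AjankiHuveneers2011_highFrequencyBound)
    (hL : AjankiHuveneers2011_criticalBandLowerBound) : AjankiHuveneers2011_spectralScaling := by
  intro τ a b ha hab h0 hoff hcont hdiff hbd hint ρ _ hρ lam hlam
  have hyp : MassDensityHyp τ a b := ⟨ha, hab, h0, hoff, hcont, hdiff, hbd, hint⟩
  obtain ⟨ω₀, hω₀, CU, hU'⟩ := hU τ a b hyp ρ hρ
  obtain ⟨CH, c, hc, hH'⟩ := hH τ a b hyp ρ hρ ω₀ hω₀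
  obtain ⟨κ, hκ, cL, hcL, n₀, hL'⟩ := hL τ a b hyp ρ hρ
  have hlo : 0 < cmpLo lam a b / Real.pi := div_pos (cmpLo_pos b hlam ha) Real.pi_pos
  have hhi : 0 < cmpHi lam a b / Real.pi := div_pos (cmpHi_pos hlam ha hab.le) Real.pi_pos
  have ht : 0 < Real.sqrt 2 := Real.sqrt_pos.mpr two_pos
  have hs2 : 0 < 1 - 1 / Real.sqrt 2 := by
    rw [sub_pos, div_lt_one ht]
    exact Real.one_lt_sqrt_two
  set K : ℝ := cmpLo lam a b / Real.pi * (cL * (κ ^ 3 * (1 - 1 / Real.sqrt 2) / 2)) with hK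
  set K' : ℝ := cmpHi lam a b / Real.pi * (2 * (max CU 0 + max CH 0 * (6 / c ^ 3))) + 1 with hK'
  refine ⟨K, K', by positivity, by positivity, max n₀ 1, fun n hn => ?_⟩
  obtain ⟨k, rfl⟩ : ∃ k, n = k + 1 := ⟨n - 1, by omega⟩
  have hn₀ : n₀ ≤ k + 1 := le_trans (le_max_left _ _) hn
  have hnpos : (0 : ℝ) < ((k + 1 : ℕ) : ℝ) := by positivity
  set s : ℝ := Real.sqrt ((k + 1 : ℕ) : ℝ) with hsdef
  have hs : 0 < s := Real.sqrt_pos.mpr hnpos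
  have h32 : ((k + 1 : ℕ) : ℝ) ^ (3 / 2 : ℝ) = s ^ 2 * s := by
    rw [hsdef, Real.sq_sqrt hnpos.le, show (3 / 2 : ℝ) = 1 + 1 / 2 by norm_num,
      Real.rpow_add hnpos, Real.rpow_one, Real.sqrt_eq_rpow]
  have hae := ae_pi_mem_Icc hoff hρ (k + 1)
  -- integrability of the mass average over all frequencies
  obtain ⟨hHi, hHb⟩ := hH' (k + 1) (Nat.succ_pos k)
  have hfin : volume (Set.Ioc (0 : ℝ) ω₀) ≠ ⊤ := by
    rw [Real.volume_Ioc]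
    exact ENNReal.ofReal_ne_top
  have hIoc := integrableOn_clAvgCurrentDensity ρ (k + 1) hfin
  have hIoi : IntegrableOn (clAvgCurrentDensity ρ (k + 1)) (Set.Ioi 0) := by
    rw [← Set.Ioc_union_Ioi_eq_Ioi hω₀.le]
    exact integrableOn_union.mpr ⟨hIoc, hHi⟩
  have hE := integrable_clAvgCurrentDensity_of_Ioi ρ (k + 1) hIoi
  obtain ⟨hInt, hup⟩ := integral_clSpectralConductance_le hlam ha ρ hae hE
  refine ⟨hInt, ?_, ?_⟩
  · -- the lower bound from the critical band
    set p : ℝ := κ / (Real.sqrt 2 * s) with hp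
    set q : ℝ := κ / s with hq
    have hp2 : Real.sqrt (2 * ((k + 1 : ℕ) : ℝ)) = Real.sqrt 2 * s := by
      rw [hsdef, Real.sqrt_mul (by norm_num : (0 : ℝ) ≤ 2)]
    have hp_pos : 0 < p := by positivity
    have hpq : p ≤ q := by
      rw [hp, hq]
      refine div_le_div_of_nonneg_left hκ.le hs ?_
      calc s = 1 * s := (one_mul s).symm
        _ ≤ Real.sqrt 2 * s := mul_le_mul_of_nonneg_right Real.one_lt_sqrt_two.le hs.le
    set S : Set ℝ := Set.Icc p q with hSdef
    have hSfin : volume S ≠ ⊤ := by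
      rw [hSdef, Real.volume_Icc]
      exact ENNReal.ofReal_ne_top
    have hlow := setIntegral_le_integral_clSpectralConductance hlam ha ρ hae hE S
    refine le_trans ?_ hlow
    have hstep : ∫ _ω in S, cL * p ^ 2 ≤ ∫ ω in S, clAvgCurrentDensity ρ (k + 1) ω := by
      refine setIntegral_mono_on (integrableOn_const hSfin)
        (integrableOn_clAvgCurrentDensity ρ (k + 1) hSfin) measurableSet_Icc fun ω hω => ?_
      have hω' : ω ∈ Set.Icc (κ / Real.sqrt (2 * ((k + 1 : ℕ) : ℝ))) (κ / Real.sqrt ((k + 1 : ℕ) : ℝ)) := by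
        rw [hp2]
        exact hω
      refine le_trans ?_ (hL' (k + 1) hn₀ ω hω')
      exact mul_le_mul_of_nonneg_left (pow_le_pow_left₀ hp_pos.le hω.1 2) hcL.le
    rw [setIntegral_const, Real.volume_real_Icc_of_le hpq, smul_eq_mul] at hstep
    calc K / ((k + 1 : ℕ) : ℝ) ^ (3 / 2 : ℝ)
        = cmpLo lam a b / Real.pi * ((q - p) * (cL * p ^ 2)) := by
          rw [h32, hK, hp, hq, mul_div_assoc, band_arith hs ht (Real.sq_sqrt zero_le_two)]
      _ ≤ cmpLo lam a b / Real.pi * ∫ ω in S, clAvgCurrentDensity ρ (k + 1) ω :=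
          mul_le_mul_of_nonneg_left hstep hlo.le
  · -- the upper bound from (U) and (H)
    have hsplit : ∫ ω in Set.Ioi 0, clAvgCurrentDensity ρ (k + 1) ω =
        (∫ ω in Set.Ioc 0 ω₀, clAvgCurrentDensity ρ (k + 1) ω) +
          ∫ ω in Set.Ioi ω₀, clAvgCurrentDensity ρ (k + 1) ω := by
      rw [← setIntegral_union Set.Ioc_disjoint_Ioi_same measurableSet_Ioi hIoc hHi,
        Set.Ioc_union_Ioi_eq_Ioi hω₀.le]
    have hUb := hU' (k + 1) (Nat.succ_pos k)
    have hexp : Real.exp (-(c * Real.sqrt ((k + 1 : ℕ) : ℝ))) ≤ 6 / c ^ 3 / (s ^ 2 * s) := by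
      refine (exp_neg_le_six_div_cube (by positivity)).trans (le_of_eq ?_)
      rw [← hsdef]
      field_simp
    have hinv : 0 ≤ 1 / (s ^ 2 * s) := by positivity
    calc ∫ m, clSpectralConductance m lam ∂(Measure.pi fun _ : Fin (k + 1) => ρ)
        ≤ cmpHi lam a b / Real.pi * (2 * ((∫ ω in Set.Ioc 0 ω₀, clAvgCurrentDensity ρ (k + 1) ω) +
            ∫ ω in Set.Ioi ω₀, clAvgCurrentDensity ρ (k + 1) ω)) := by rw [← hsplit]; exact hup
      _ ≤ cmpHi lam a b / Real.pi * (2 * (max CU 0 / (s ^ 2 * s) + max CH 0 * (6 / c ^ 3 / (s ^ 2 * s)))) := by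
          gcongr
          · calc ∫ ω in Set.Ioc 0 ω₀, clAvgCurrentDensity ρ (k + 1) ω ≤ CU / ((k + 1 : ℕ) : ℝ) ^ (3 / 2 : ℝ) := hUb
              _ ≤ max CU 0 / ((k + 1 : ℕ) : ℝ) ^ (3 / 2 : ℝ) :=
                  div_le_div_of_nonneg_right (le_max_left _ _) (by positivity)
              _ = max CU 0 / (s ^ 2 * s) := by rw [h32]
          · calc ∫ ω in Set.Ioi ω₀, clAvgCurrentDensity ρ (k + 1) ω
                ≤ CH * Real.exp (-(c * Real.sqrt ((k + 1 : ℕ) : ℝ))) := hHb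
              _ ≤ max CH 0 * Real.exp (-(c * Real.sqrt ((k + 1 : ℕ) : ℝ))) :=
                  mul_le_mul_of_nonneg_right (le_max_left _ _) (Real.exp_pos _).le
              _ ≤ max CH 0 * (6 / c ^ 3 / (s ^ 2 * s)) :=
                  mul_le_mul_of_nonneg_left hexp (le_max_right _ _)
      _ = (cmpHi lam a b / Real.pi * (2 * (max CU 0 + max CH 0 * (6 / c ^ 3)))) * (1 / (s ^ 2 * s)) := by
          ring
      _ ≤ K' * (1 / (s ^ 2 * s)) := by
          refine mul_le_mul_of_nonneg_right ?_ hinv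
          rw [hK']
          linarith
      _ = K' / ((k + 1 : ℕ) : ℝ) ^ (3 / 2 : ℝ) := by rw [h32]; ring

end Literature.Barriers.AtomisticToContinuum

end
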